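import Mathlib.Analysis.InnerProductSpace.Basic
import HarnessLib

/-!
# RiemannHypothesis / GroundBarta — rung 4 (`EvenWinsBeyondArch`, stmt-RiemannHypothesis-18807):
# the deflated Temple (Lehmann–Maehly) L-side programme, XII — the `k × k` PSD hypothesis from finite data

Helper file (`--supports stmt-RiemannHypothesis-18807`), RH-free, Mathlib only, no definitions, no named facts.

The deflated Temple bound (`dt_sector_bound_of_ritz`, `dt_weil{Even,Odd}GroundEnergy_ge_of_ritz`, `…_of_checkR₁`) carries ONE
analytic-numerical hypothesis on the Ritz data, the positive semi-definiteness of a real symmetric `k × k` matrix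
`M_ij = (β−λ)(A_ij − λ G_ij) − R_ij` whose entries are integrals (pole form, Dirichlet energy, `L²` pairings of the window
images): `hPSD : ∀ α, 0 ≤ Σ_i Σ_j α_i α_j M_ij`.  This file reduces `hPSD` to what a validated-numerics seat produces:

* entrywise ENCLOSURES `|M_ij − P_ij| ≤ E_ij` with rational `P`, `E` (interval arithmetic),
* a rational MARGIN certificate `P = δ·1 + Lᵀ diag(D) L`, `D ≥ 0` (exact `LDLᵀ` of `P − δ 1` over `ℚ`, checkable by `norm_num`),
* the Gershgorin-type budget `Σ_j E_ij ≤ δ`, `Σ_i E_ij ≤ δ`.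

`dt_quadForm_ge_of_ldl` (margin from `LDLᵀ`), `dt_quadForm_nonneg_of_near` (perturbation), `dt_psd_of_certificate` (both, rational
data).  Prover B, speedrun unit `sr-gb-rung-b` (gen 3).

References: A. Weinstein, W. Stenger, *Methods of intermediate problems for eigenvalues* (1972) Ch. 5 §9 [WeinsteinStenger1972];
S. M. Rump, *Verification of positive definiteness*, BIT 46 (2006) 433–452, §2 (definiteness from an approximate factorisation plus a
perturbation bound) [Rump2006PosDef].
-/

set_option linter.dupNamespace false

noncomputable section

open Finset
open scoped BigOperators

namespace Summit.RiemannHypothesis.RiemannHypothesis.Theorems.EvenWinsBeyondArch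

/-- **Margin from an `LDLᵀ` factorisation**: if `P = δ·1 + Lᵀ diag(D) L` with `D ≥ 0` then `δ‖α‖² ≤ αᵀ P α`. [folklore] -/
theorem dt_quadForm_ge_of_ldl {k m : ℕ} (P : Fin k → Fin k → ℝ) (D : Fin m → ℝ) (L : Fin m → Fin k → ℝ) (δ : ℝ)
    (hD : ∀ r, 0 ≤ D r) (hP : ∀ i j, P i j = δ * (if i = j then 1 else 0) + ∑ r, D r * L r i * L r j)
    (α : Fin k → ℝ) : δ * ∑ i, α i ^ 2 ≤ ∑ i, ∑ j, α i * α j * P i j := by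
  -- split the quadratic form into the diagonal margin and the Gram part
  have hsplit : ∑ i, ∑ j, α i * α j * P i j =
      (∑ i, ∑ j, α i * α j * (δ * (if i = j then 1 else 0))) + ∑ i, ∑ j, α i * α j * ∑ r, D r * L r i * L r j := by
    rw [← Finset.sum_add_distrib]
    refine Finset.sum_congr rfl fun i _ ↦ ?_
    rw [← Finset.sum_add_distrib]
    exact Finset.sum_congr rfl fun j _ ↦ by rw [hP i j]; ring
  have hdiag : ∑ i, ∑ j, α i * α j * (δ * (if i = j then 1 else 0)) = δ * ∑ i, α i ^ 2 := by
    have : ∀ i : Fin k, ∑ j, α i * α j * (δ * (if i = j then 1 else 0)) = δ * α i ^ 2 := by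
      intro i
      rw [Finset.sum_eq_single i (fun j _ hji ↦ by rw [if_neg (Ne.symm hji)]; ring) (fun h ↦ (h (mem_univ i)).elim),
        if_pos rfl]
      ring
    simp_rw [this, ← Finset.mul_sum]
  have hgram : ∑ i, ∑ j, α i * α j * ∑ r, D r * L r i * L r j = ∑ r, D r * (∑ i, L r i * α i) ^ 2 := by
    have hsq : ∀ r, D r * (∑ i, L r i * α i) ^ 2 = ∑ i, ∑ j, α i * α j * (D r * L r i * L r j) := by
      intro r
      rw [sq, Finset.sum_mul_sum, Finset.mul_sum]
      refine Finset.sum_congr rfl fun i _ ↦ ?_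
      rw [Finset.mul_sum]
      exact Finset.sum_congr rfl fun j _ ↦ by ring
    simp_rw [hsq, Finset.mul_sum]
    calc ∑ i, ∑ j, ∑ r, α i * α j * (D r * L r i * L r j)
        = ∑ i, ∑ r, ∑ j, α i * α j * (D r * L r i * L r j) := Finset.sum_congr rfl fun i _ ↦ Finset.sum_comm
      _ = ∑ r, ∑ i, ∑ j, α i * α j * (D r * L r i * L r j) := Finset.sum_comm
  rw [hsplit, hdiag, hgram]
  have h0 : 0 ≤ ∑ r, D r * (∑ i, L r i * α i) ^ 2 := Finset.sum_nonneg fun r _ ↦ mul_nonneg (hD r) (sq_nonneg _)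
  linarith

/-- **Perturbation**: entrywise enclosures `|M_ij − P_ij| ≤ E_ij` with row and column sums of `E` at most `δ`, and the
margin `δ‖α‖² ≤ αᵀPα`, give `αᵀ M α ≥ 0` (since `|α_i α_j| ≤ (α_i² + α_j²)/2`).
[cite: Rump2006PosDef, §2 (perturbation argument)] -/
theorem dt_quadForm_nonneg_of_near {k : ℕ} (M P E : Fin k → Fin k → ℝ) (δ : ℝ)
    (hE : ∀ i j, |M i j - P i j| ≤ E i j) (hrow : ∀ i, ∑ j, E i j ≤ δ) (hcol : ∀ j, ∑ i, E i j ≤ δ)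
    (hP : ∀ α : Fin k → ℝ, δ * ∑ i, α i ^ 2 ≤ ∑ i, ∑ j, α i * α j * P i j) (α : Fin k → ℝ) :
    0 ≤ ∑ i, ∑ j, α i * α j * M i j := by
  -- entrywise: α_i α_j M_ij ≥ α_i α_j P_ij − (α_i² + α_j²)/2 · E_ij
  have h1 : ∀ i j, α i * α j * P i j - (α i ^ 2 + α j ^ 2) / 2 * E i j ≤ α i * α j * M i j := by
    intro i j
    have hEnn : 0 ≤ E i j := (abs_nonneg _).trans (hE i j)
    have hab : |α i * α j| ≤ (α i ^ 2 + α j ^ 2) / 2 := by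
      rw [abs_le]; constructor <;> nlinarith [sq_nonneg (α i + α j), sq_nonneg (α i - α j)]
    have h3 : |α i * α j * (M i j - P i j)| ≤ (α i ^ 2 + α j ^ 2) / 2 * E i j := by
      rw [abs_mul]
      exact mul_le_mul hab (hE i j) (abs_nonneg _) (by positivity)
    have h4 := neg_abs_le (α i * α j * (M i j - P i j))
    nlinarith
  -- the error budget: Σ_ij (α_i² + α_j²)/2 · E_ij ≤ δ‖α‖²
  have h2 : ∑ i, ∑ j, (α i ^ 2 + α j ^ 2) / 2 * E i j ≤ δ * ∑ i, α i ^ 2 := by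
    have hsplit : ∑ i, ∑ j, (α i ^ 2 + α j ^ 2) / 2 * E i j =
        (∑ i, α i ^ 2 / 2 * ∑ j, E i j) + ∑ j, α j ^ 2 / 2 * ∑ i, E i j := by
      simp_rw [Finset.mul_sum]
      rw [Finset.sum_comm (f := fun j i ↦ α j ^ 2 / 2 * E i j), ← Finset.sum_add_distrib]
      refine Finset.sum_congr rfl fun i _ ↦ ?_
      rw [← Finset.sum_add_distrib]
      exact Finset.sum_congr rfl fun j _ ↦ by ring
    rw [hsplit]
    have ha : ∑ i, α i ^ 2 / 2 * ∑ j, E i j ≤ ∑ i, α i ^ 2 / 2 * δ :=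
      Finset.sum_le_sum fun i _ ↦ mul_le_mul_of_nonneg_left (hrow i) (by positivity)
    have hb : ∑ j, α j ^ 2 / 2 * ∑ i, E i j ≤ ∑ j, α j ^ 2 / 2 * δ :=
      Finset.sum_le_sum fun j _ ↦ mul_le_mul_of_nonneg_left (hcol j) (by positivity)
    have hc : ∑ i, α i ^ 2 / 2 * δ = δ / 2 * ∑ i, α i ^ 2 := by
      rw [Finset.mul_sum]; exact Finset.sum_congr rfl fun i _ ↦ by ring
    linarith
  -- assemble
  have h3 : ∑ i, ∑ j, (α i * α j * P i j - (α i ^ 2 + α j ^ 2) / 2 * E i j) ≤ ∑ i, ∑ j, α i * α j * M i j :=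
    Finset.sum_le_sum fun i _ ↦ Finset.sum_le_sum fun j _ ↦ h1 i j
  have h4 : ∑ i, ∑ j, (α i * α j * P i j - (α i ^ 2 + α j ^ 2) / 2 * E i j) =
      (∑ i, ∑ j, α i * α j * P i j) - ∑ i, ∑ j, (α i ^ 2 + α j ^ 2) / 2 * E i j := by
    rw [← Finset.sum_sub_distrib]
    exact Finset.sum_congr rfl fun i _ ↦ Finset.sum_sub_distrib _ _
  linarith [hP α]

/-- **The PSD hypothesis of the deflated Temple bound from a finite certificate.**  Rational data: an approximant `P`, error
bounds `E` with `|M_ij − P_ij| ≤ E_ij` (the only analytic input — interval enclosures of the `k²` integrals), row/column sums of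
`E` at most `δ`, and an exact factorisation `P = δ·1 + Lᵀ diag(D) L`, `D ≥ 0` over `ℚ`.  Then `∀ α, 0 ≤ Σ_i Σ_j α_i α_j M_ij` —
literally the hypothesis `hPSD` of `dt_sector_bound_of_ritz` / `dt_weil{Even,Odd}GroundEnergy_ge_of_{ritz,checkR₁}` with
`M i j` its bracket. [cite: Rump2006PosDef, §2 (perturbation argument)] -/
theorem dt_psd_of_certificate {k m : ℕ} (M : Fin k → Fin k → ℝ) (P E : Fin k → Fin k → ℚ) (D : Fin m → ℚ)
    (L : Fin m → Fin k → ℚ) (δ : ℚ) (hE : ∀ i j, |M i j - P i j| ≤ E i j) (hrow : ∀ i, ∑ j, E i j ≤ δ)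
    (hcol : ∀ j, ∑ i, E i j ≤ δ) (hD : ∀ r, 0 ≤ D r)
    (hP : ∀ i j, P i j = δ * (if i = j then 1 else 0) + ∑ r, D r * L r i * L r j) (α : Fin k → ℝ) :
    0 ≤ ∑ i, ∑ j, α i * α j * M i j := by
  refine dt_quadForm_nonneg_of_near M (fun i j ↦ (P i j : ℝ)) (fun i j ↦ (E i j : ℝ)) δ hE
    (fun i ↦ by exact_mod_cast hrow i) (fun j ↦ by exact_mod_cast hcol j)
    (dt_quadForm_ge_of_ldl _ (fun r ↦ (D r : ℝ)) (fun r i ↦ (L r i : ℝ)) δ (fun r ↦ by exact_mod_cast hD r)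
      fun i j ↦ ?_) α
  rw [hP i j]
  split_ifs <;> push_cast <;> ring

end Summit.RiemannHypothesis.RiemannHypothesis.Theorems.EvenWinsBeyondArch

end
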